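import Mathlib.Topology.MetricSpace.Thickening
import Literature.Analysis.FunctionSpaces.MollificationLp
import HarnessLib

/-!
# `L^p` bounds by duality against smooth test functions supported in an open set

Analysis/FunctionSpaces support file (all results proved, [folklore]). It serves the discharge of
the pressure localisation of Lemarié-Rieusset 2016, (13.20) p. 461
(`Literature.Analysis.FluidPDE.LemarieRieusset2016.pressure_splitting`,
`FluidPDE/CKNPressureLocalization`), where the `L^{5/3}` integrability of the local pressure is
obtained by testing it against `Ψ ∈ C_c^∞(I × B)` and bounding `|∫ p Ψ|` by `‖Ψ‖_{L^{5/2}}`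
(the Calderón–Zygmund estimate is applied to the test function, not to the pressure).

Let `G` be a finite-dimensional real normed space with an additive Haar measure `μ`, `S ⊆ G`
open, `E : G → ℝ` integrable on `S`, `1 < p < ∞` and `q` the conjugate exponent. The statement
proved here is the elementary half of the duality `L^p(S) = (L^q(S))'` (Brezis 2011, Prop. 3.5,
Thm. 4.11; Adams–Fournier 2003, Thm. 2.44 (Riesz representation) is the full statement):

* `abs_setIntegral_mul_le_of_forall_test` — if `|∫_S E Ψ| ≤ M ‖Ψ‖_{L^q}` for every smooth
  compactly supported `Ψ` with `tsupport Ψ ⊆ S`, then the same bound holds for every bounded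
  strongly measurable `g` vanishing off a compact subset of `S` (mollify `g`: the mollified
  functions are test functions supported in `S`, uniformly bounded, converge a.e. to `g` by
  Lebesgue differentiation — Mathlib's `ContDiffBump.ae_convolution_tendsto_right_of_locallyIntegrable`
  — and do not increase the `L^q` norm (Young); dominated convergence on the `E` side, which is
  why only `E ∈ L¹(S)` is needed);
* `lintegral_rpow_enorm_le_of_forall_test` — under the same hypothesis,
  `∫_S |E|^p ≤ M^p`: test with `g = 𝟙_T |E|^{p-2} E` on the truncation sets
  `T_k = K_k ∩ {|E| ≤ k}` along a compact exhaustion `K_k ↑ S`, for which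
  `∫_S E g = ∫_{T_k} |E|^p = ‖g‖_q^q`, whence `∫_{T_k} |E|^p ≤ M^p`, and let `k → ∞` (monotone
  convergence);
* `memLp_of_forall_test` — the `MemLp`/`eLpNorm` form: `E ∈ L^p(S)` with `‖E‖_{L^p(S)} ≤ M`.

The tree has the whole-space `L²_loc`-version for vector fields and `p = 3`
(`Literature.Analysis.FunctionSpaces.memLp_three_of_forall_abs_integral_inner_le`,
`TestPairingLimits`, by `L²` density of test fields); the version here assumes only `E ∈ L¹(S)`
and tests supported in a prescribed open set, as needed when `E` is a pressure known a priori
only in `L^{q₀}_t L¹_x`.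

## Mathlib search

Mathlib (this pin) has no `L^p`–`L^q` duality for `p ≠ 2` (searched `dual` and `HolderConjugate`
in `MeasureTheory/Function/LpSpace`, `LpSeminorm`: only Hölder's inequality
`ENNReal.lintegral_mul_le_Lp_mul_Lq` and the `L²` inner product space structure). Used:
`ContDiffBump` on finite-dimensional spaces, `dist_convolution_le`,
`ContDiffBump.ae_convolution_tendsto_right_of_locallyIntegrable`, `support_convolution_subset`,
`IsCompact.exists_cthickening_subset_open`, `tendsto_integral_of_dominated_convergence`,
`lintegral_iSup`; from the tree `eLpNorm_normed_convolution_le_haar` (Young) and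
`exists_contDiffBump_seq` (`FunctionSpaces/Mollification`, `MollificationLp`).

## References

* H. Brezis, *Functional Analysis, Sobolev Spaces and Partial Differential Equations* (2011),
  Prop. 3.5, Thm. 4.11, Cor. 4.24.
* R. A. Adams, J. J. F. Fournier, *Sobolev Spaces*, 2nd ed. (2003), Thm. 2.29 (mollifiers),
  Thm. 2.44 (Riesz representation for `L^p`).
-/

noncomputable section

open MeasureTheory TopologicalSpace Set Function Filter Topology ContinuousLinearMap Metric
open scoped ENNReal NNReal Convolution Pointwise

namespace Literature.Analysis.FunctionSpaces

variable {G : Type*} [NormedAddCommGroup G] [NormedSpace ℝ G] [FiniteDimensional ℝ G]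
  [MeasurableSpace G] [BorelSpace G] {μ : Measure G} [μ.IsAddHaarMeasure]

/-! ### A compact exhaustion of an open set -/

omit [NormedSpace ℝ G] [FiniteDimensional ℝ G] [MeasurableSpace G] [BorelSpace G] in
/-- The compact sets `K_k = B̄(0, k) ∩ {x | (k+1)⁻¹ ≤ dist(x, Sᶜ)}` exhausting an open set `S` of a
proper normed space: compact, contained in `S`, increasing, and eventually containing each point
of `S`. [folklore] -/
theorem exists_compact_exhaustion_of_isOpen [ProperSpace G] {S : Set G} (hS : IsOpen S) :
    ∃ K : ℕ → Set G, (∀ k, IsCompact (K k)) ∧ (∀ k, K k ⊆ S) ∧ Monotone K ∧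
      ∀ x ∈ S, ∃ k₀, ∀ k, k₀ ≤ k → x ∈ K k := by
  set K : ℕ → Set G := fun k => closedBall (0 : G) k ∩
    {x | ((k : ℝ≥0∞) + 1)⁻¹ ≤ Metric.infEDist x Sᶜ} with hK
  have hclosed : ∀ k, IsClosed (K k) := fun k =>
    isClosed_closedBall.inter (isClosed_le continuous_const Metric.continuous_infEDist)
  refine ⟨K, fun k => (isCompact_closedBall (0 : G) k).of_isClosed_subset (hclosed k)
    inter_subset_left, fun k x hx => ?_, fun k l hkl x hx => ?_, fun x hx => ?_⟩
  · -- `K_k ⊆ S`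
    have hpos : 0 < Metric.infEDist x Sᶜ := lt_of_lt_of_le (ENNReal.inv_pos.2 (by simp)) hx.2
    have hx' : x ∉ closure Sᶜ := (Metric.infEDist_pos_iff_notMem_closure).1 hpos
    rw [hS.isClosed_compl.closure_eq] at hx'
    exact not_notMem.1 hx'
  · -- monotone
    refine ⟨closedBall_subset_closedBall (by exact_mod_cast hkl) hx.1, ?_⟩
    show ((l : ℝ≥0∞) + 1)⁻¹ ≤ Metric.infEDist x Sᶜ
    exact le_trans (ENNReal.inv_le_inv.2 (by gcongr)) hx.2
  · -- covering
    have hpos : 0 < Metric.infEDist x Sᶜ := by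
      rw [Metric.infEDist_pos_iff_notMem_closure, hS.isClosed_compl.closure_eq]
      exact fun h => h hx
    obtain ⟨n, hn⟩ := ENNReal.exists_inv_nat_lt hpos.ne'
    refine ⟨max n ⌈‖x‖⌉₊, fun k hk => ⟨?_, ?_⟩⟩
    · rw [mem_closedBall, dist_zero_right]
      exact (Nat.le_ceil ‖x‖).trans (by exact_mod_cast (le_max_right _ _).trans hk)
    · refine le_trans (ENNReal.inv_le_inv.2 ?_) hn.le
      have : (n : ℝ≥0∞) ≤ k := by exact_mod_cast (le_max_left _ _).trans hk
      exact this.trans le_self_add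

/-! ### Extension of the test-function bound to bounded functions -/

/-- **Extension of a test-function bound to bounded functions supported in a compact subset.**
Let `S` be open, `E ∈ L¹(S, μ)`, `1 ≤ q`, `0 ≤ M`, and suppose `|∫_S E Ψ dμ| ≤ M ‖Ψ‖_{L^q(μ)}`
for every smooth compactly supported `Ψ` with `tsupport Ψ ⊆ S`. Then for every strongly
measurable `g` with `|g| ≤ C` vanishing off a compact `K ⊆ S`, `|∫_S E g dμ| ≤ M ‖g‖_{L^q(μ)}`.
Proof: mollify `g` by normalised bump kernels of radius `→ 0`; for small radius the mollified
functions are test functions supported in a fixed compact neighbourhood of `K` inside `S`, bounded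
by `C`, with `L^q` norm `≤ ‖g‖_q` (Young), and they converge to `g` a.e. (Lebesgue
differentiation), so dominated convergence applies to `∫_S E gₙ`. [folklore] -/
theorem abs_setIntegral_mul_le_of_forall_test {S : Set G} (hS : IsOpen S) {E : G → ℝ}
    (hE : IntegrableOn E S μ) {q : ℝ≥0∞} (hq : 1 ≤ q) {M : ℝ} (hM : 0 ≤ M)
    (h : ∀ Ψ : G → ℝ, ContDiff ℝ (⊤ : ℕ∞) Ψ → HasCompactSupport Ψ → tsupport Ψ ⊆ S →
      |∫ x in S, E x * Ψ x ∂μ| ≤ M * (eLpNorm Ψ q μ).toReal)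
    {K : Set G} (hK : IsCompact K) (hKS : K ⊆ S) {g : G → ℝ} (hgm : StronglyMeasurable g)
    {C : ℝ} (hgC : ∀ x, |g x| ≤ C) (hgK : ∀ x, x ∉ K → g x = 0) :
    |∫ x in S, E x * g x ∂μ| ≤ M * (eLpNorm g q μ).toReal := by
  -- room around `K` inside `S`
  obtain ⟨δ, hδ, hδS⟩ := hK.exists_cthickening_subset_open hS hKS
  -- the class of `g`
  have hC : 0 ≤ C := (abs_nonneg _).trans (hgC 0)
  have hgc : HasCompactSupport g := HasCompactSupport.intro hK hgK
  have hgam : AEStronglyMeasurable g μ := hgm.aestronglyMeasurable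
  have hgsupp : support g ⊆ K := fun x hx => by_contra fun hxK => hx (hgK x hxK)
  have hgn : ∀ x, ‖g x‖ ≤ C := fun x => (Real.norm_eq_abs _).trans_le (hgC x)
  have hgi : Integrable g μ := by
    rw [← integrableOn_iff_integrable_of_support_subset hgsupp]
    exact Measure.integrableOn_of_bounded hK.measure_lt_top.ne hgam
      (Eventually.of_forall hgn)
  have hgl : LocallyIntegrable g μ := hgi.locallyIntegrable
  have hgtop : MemLp g ⊤ μ := memLp_top_of_bound hgam C (Eventually.of_forall hgn)
  have hgq : MemLp g q μ :=
    hgtop.mono_exponent_of_measure_support_ne_top (s := K) hgK hK.measure_lt_top.ne le_top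
  have hgq' : eLpNorm g q μ ≠ ∞ := hgq.eLpNorm_ne_top
  -- the mollifier sequence
  obtain ⟨φ, hφ0, hφ2⟩ := exists_contDiffBump_seq (E := G)
  set gs : ℕ → G → ℝ := fun n => (φ n).normed μ ⋆[lsmul ℝ ℝ, μ] g with hgs
  have hev : ∀ᶠ n in atTop, (φ n).rOut < δ := hφ0.eventually (gt_mem_nhds hδ)
  have hsm : ∀ n, ContDiff ℝ (⊤ : ℕ∞) (gs n) := fun n =>
    (φ n).hasCompactSupport_normed.contDiff_convolution_left _ (φ n).contDiff_normed hgl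
  have hcs : ∀ n, HasCompactSupport (gs n) := fun n =>
    (φ n).hasCompactSupport_normed.convolution _ hgc
  have hts : ∀ n, (φ n).rOut ≤ δ → tsupport (gs n) ⊆ S := by
    intro n hn
    refine Subset.trans (closure_minimal ?_ isClosed_cthickening)
      ((cthickening_mono hn K).trans hδS)
    intro x hx
    have h1 := support_convolution_subset (L := lsmul ℝ ℝ) (μ := μ) (f := (φ n).normed μ)
      (g := g) hx
    rw [(φ n).support_normed_eq] at h1
    obtain ⟨a, ha, b, hb, rfl⟩ := h1
    refine thickening_subset_cthickening _ _ (mem_thickening_iff.2 ⟨b, hgsupp hb, ?_⟩)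
    rw [dist_eq_norm, add_sub_cancel_right]
    exact mem_ball_zero_iff.1 ha
  have hbd : ∀ n x, |gs n x| ≤ C := by
    intro n x
    have := dist_convolution_le (μ := μ) (x₀ := x) (z₀ := (0 : ℝ)) hC
      (φ n).support_normed_eq.subset (φ n).nonneg_normed (φ n).integral_normed hgam
      (fun y _ => by rw [dist_zero_right]; exact hgn y)
    rwa [Real.dist_eq, sub_zero] at this
  have hY : ∀ n, eLpNorm (gs n) q μ ≤ eLpNorm g q μ := fun n =>
    eLpNorm_normed_convolution_le_haar (φ n) hgam hq
  -- a.e. convergence and dominated convergence on the `E` side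
  have hae : ∀ᵐ x ∂μ, Tendsto (fun n => gs n x) atTop (𝓝 (g x)) :=
    ContDiffBump.ae_convolution_tendsto_right_of_locallyIntegrable hφ0
      (Eventually.of_forall hφ2) hgl
  have hlim : Tendsto (fun n => ∫ x in S, E x * gs n x ∂μ) atTop
      (𝓝 (∫ x in S, E x * g x ∂μ)) := by
    refine tendsto_integral_of_dominated_convergence (fun x => C * ‖E x‖)
      (fun n => hE.aestronglyMeasurable.mul
        (hsm n).continuous.aestronglyMeasurable) (hE.norm.const_mul C) (fun n => ?_) ?_
    · filter_upwards with x
      rw [norm_mul, mul_comm]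
      exact mul_le_mul_of_nonneg_right ((Real.norm_eq_abs _).trans_le (hbd n x))
        (norm_nonneg _)
    · exact (ae_restrict_of_ae hae).mono fun x hx => hx.const_mul (E x)
  -- pass to the limit in the bound for the mollified functions
  have hevb : ∀ᶠ n in atTop, |∫ x in S, E x * gs n x ∂μ| ≤ M * (eLpNorm g q μ).toReal := by
    filter_upwards [hev] with n hn
    refine (h (gs n) (hsm n) (hcs n) (hts n hn.le)).trans ?_
    exact mul_le_mul_of_nonneg_left (ENNReal.toReal_mono hgq' (hY n)) hM
  exact le_of_tendsto ((continuous_abs.tendsto _).comp hlim) hevb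

/-! ### The `L^p` bound -/

/-- **`∫_S |E|^p ≤ M^p` from a bound on pairings with test functions.** Let `S` be open,
`E ∈ L¹(S, μ)`, `p, q` conjugate exponents (`1 < p < ∞`), `0 ≤ M`, and suppose
`|∫_S E Ψ dμ| ≤ M ‖Ψ‖_{L^q(μ)}` for every smooth compactly supported `Ψ` with `tsupport Ψ ⊆ S`.
Then `∫_S |E|^p dμ ≤ M^p`; in particular `E ∈ L^p(S)` (Brezis 2011, Prop. 3.5 / Thm. 4.11, the
easy half of `(L^q)' = L^p`). Proof: along a compact exhaustion `K_k ↑ S`, test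
(`abs_setIntegral_mul_le_of_forall_test`) with `g = 𝟙_{T_k} |E|^{p-2} E`,
`T_k = K_k ∩ {|E| ≤ k}`: `∫_S E g = ∫_{T_k} |E|^p` and `‖g‖_q^q = ∫_{T_k} |E|^p`, so
`∫_{T_k} |E|^p ≤ M^p`; monotone convergence in `k`. [folklore] -/
theorem lintegral_rpow_enorm_le_of_forall_test {S : Set G} (hS : IsOpen S) {E : G → ℝ}
    (hE : IntegrableOn E S μ) {p q : ℝ} (hpq : p.HolderConjugate q) {M : ℝ} (hM : 0 ≤ M)
    (h : ∀ Ψ : G → ℝ, ContDiff ℝ (⊤ : ℕ∞) Ψ → HasCompactSupport Ψ → tsupport Ψ ⊆ S →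
      |∫ x in S, E x * Ψ x ∂μ| ≤ M * (eLpNorm Ψ (ENNReal.ofReal q) μ).toReal) :
    ∫⁻ x in S, ‖E x‖ₑ ^ p ∂μ ≤ ENNReal.ofReal (M ^ p) := by
  have hp1 : 1 < p := hpq.lt
  have hp0 : 0 < p := hpq.pos
  have hq0 : 0 < q := hpq.symm.pos
  have hq1' : 1 < q := hpq.symm.lt
  have hq1 : 1 ≤ ENNReal.ofReal q := by
    rw [← ENNReal.ofReal_one]; exact ENNReal.ofReal_le_ofReal hq1'.le
  have hq0' : ENNReal.ofReal q ≠ 0 := (zero_lt_one.trans_le hq1).ne'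
  have hqr : (ENNReal.ofReal q).toReal = q := ENNReal.toReal_ofReal hq0.le
  have hpinv : 1 / p + 1 / q = 1 := by
    simpa only [one_div] using hpq.inv_add_inv_eq_one
  -- ### a strongly measurable representative `F` of `E` on `S`
  set F : G → ℝ := hE.aestronglyMeasurable.mk E with hF_def
  have hFm : StronglyMeasurable F := hE.aestronglyMeasurable.stronglyMeasurable_mk
  have hEF : E =ᵐ[μ.restrict S] F := hE.aestronglyMeasurable.ae_eq_mk
  have hFi : IntegrableOn F S μ := Integrable.congr hE hEF
  have hF : ∀ Ψ : G → ℝ, ContDiff ℝ (⊤ : ℕ∞) Ψ → HasCompactSupport Ψ → tsupport Ψ ⊆ S →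
      |∫ x in S, F x * Ψ x ∂μ| ≤ M * (eLpNorm Ψ (ENNReal.ofReal q) μ).toReal := by
    intro Ψ h1 h2 h3
    rw [← integral_congr_ae (show (fun x => E x * Ψ x) =ᵐ[μ.restrict S] fun x => F x * Ψ x from
      hEF.mono fun x hx => by simp only [hx])]
    exact h Ψ h1 h2 h3
  suffices hmain : ∫⁻ x in S, ‖F x‖ₑ ^ p ∂μ ≤ ENNReal.ofReal (M ^ p) by
    rw [lintegral_congr_ae (show (fun x => ‖E x‖ₑ ^ p) =ᵐ[μ.restrict S] fun x => ‖F x‖ₑ ^ p from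
      hEF.mono fun x hx => by simp only [hx])]
    exact hmain
  -- ### the truncation sets `T k = K k ∩ {|F| ≤ k}`
  obtain ⟨K, hKc, hKS, hKmono, hKcov⟩ := exists_compact_exhaustion_of_isOpen hS
  set T : ℕ → Set G := fun k => K k ∩ {x | ‖F x‖ ≤ k} with hT_def
  have hTm : ∀ k, MeasurableSet (T k) := fun k =>
    (hKc k).isClosed.measurableSet.inter (measurableSet_le hFm.norm.measurable measurable_const)
  have hTK : ∀ k, T k ⊆ K k := fun k => inter_subset_left
  have hTS : ∀ k, T k ⊆ S := fun k => (hTK k).trans (hKS k)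
  have hTmono : Monotone T := fun k l hkl x hx =>
    ⟨hKmono hkl hx.1, le_trans (show ‖F x‖ ≤ (k : ℝ) from hx.2) (by exact_mod_cast hkl)⟩
  have hTfin : ∀ k, μ (T k) < ∞ := fun k => (measure_mono (hTK k)).trans_lt (hKc k).measure_lt_top
  -- the densities
  set Φ : G → ℝ≥0∞ := fun x => ‖F x‖ₑ ^ p with hΦ_def
  have hΦm : Measurable Φ := hFm.measurable.enorm.pow_const p
  have hΦeq : ∀ x, Φ x = ENNReal.ofReal (‖F x‖ ^ p) := fun x => by
    rw [hΦ_def]; dsimp only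
    rw [← ofReal_norm, ENNReal.ofReal_rpow_of_nonneg (norm_nonneg _) hp0.le]
  set L : ℕ → ℝ≥0∞ := fun k => ∫⁻ x in T k, Φ x ∂μ with hL_def
  have hLfin : ∀ k, L k ≠ ∞ := by
    intro k
    have hle : L k ≤ ENNReal.ofReal ((k : ℝ) ^ p) * μ (T k) :=
      calc L k ≤ ∫⁻ _ in T k, ENNReal.ofReal ((k : ℝ) ^ p) ∂μ := by
            refine setLIntegral_mono measurable_const fun x hx => ?_
            rw [hΦeq]
            exact ENNReal.ofReal_le_ofReal (Real.rpow_le_rpow (norm_nonneg _) hx.2 hp0.le)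
        _ = ENNReal.ofReal ((k : ℝ) ^ p) * μ (T k) := setLIntegral_const _ _
    exact ne_top_of_le_ne_top (ENNReal.mul_ne_top ENNReal.ofReal_ne_top (hTfin k).ne) hle
  -- ### the test functions `g k = 𝟙_{T k} F |F|^{p-2}`
  set g : ℕ → G → ℝ := fun k => (T k).indicator fun x => F x * ‖F x‖ ^ (p - 2) with hg_def
  have hgm : ∀ k, StronglyMeasurable (g k) := fun k =>
    (hFm.measurable.mul (hFm.measurable.norm.pow_const (p - 2))).stronglyMeasurable.indicator
      (hTm k)
  -- `|g k| = 𝟙_{T k} |F|^{p-1}`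
  have hgnorm : ∀ k x, ‖g k x‖ = (T k).indicator (fun x => ‖F x‖ ^ (p - 1)) x := by
    intro k x
    by_cases hx : x ∈ T k
    · rw [hg_def]; dsimp only
      rw [indicator_of_mem hx, indicator_of_mem hx, norm_mul, Real.norm_eq_abs (‖F x‖ ^ (p - 2)),
        abs_of_nonneg (Real.rpow_nonneg (norm_nonneg _) _)]
      by_cases h0 : F x = 0
      · rw [h0, norm_zero, zero_mul, Real.zero_rpow (by linarith)]
      · rw [show p - 1 = 1 + (p - 2) by ring, Real.rpow_add (norm_pos_iff.2 h0), Real.rpow_one]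
    · rw [hg_def]; dsimp only
      rw [indicator_of_notMem hx, indicator_of_notMem hx, norm_zero]
  have hgC : ∀ k x, |g k x| ≤ (k : ℝ) ^ (p - 1) := by
    intro k x
    rw [← Real.norm_eq_abs, hgnorm k x]
    by_cases hx : x ∈ T k
    · rw [indicator_of_mem hx]
      exact Real.rpow_le_rpow (norm_nonneg _) hx.2 (by linarith)
    · rw [indicator_of_notMem hx]
      exact Real.rpow_nonneg (Nat.cast_nonneg _) _
  have hgK : ∀ k x, x ∉ K k → g k x = 0 := fun k x hx =>
    indicator_of_notMem (fun hxT => hx (hTK k hxT)) _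
  -- `F · g k = 𝟙_{T k} |F|^p`
  have hFg : ∀ k x, F x * g k x = (T k).indicator (fun x => ‖F x‖ ^ p) x := by
    intro k x
    by_cases hx : x ∈ T k
    · rw [hg_def]; dsimp only
      rw [indicator_of_mem hx, indicator_of_mem hx, ← mul_assoc, ← abs_mul_abs_self (F x),
        ← Real.norm_eq_abs]
      by_cases h0 : F x = 0
      · rw [h0, norm_zero, zero_mul, zero_mul, Real.zero_rpow hp0.ne']
      · rw [show p = 2 + (p - 2) by ring, Real.rpow_add (norm_pos_iff.2 h0), Real.rpow_two, sq]
        ring_nf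
    · rw [hg_def]; dsimp only
      rw [indicator_of_notMem hx, indicator_of_notMem hx, mul_zero]
  -- `‖g k‖ₑ^q = 𝟙_{T k} Φ`
  have hgq : ∀ k x, ‖g k x‖ₑ ^ q = (T k).indicator Φ x := by
    intro k x
    rw [← ofReal_norm, hgnorm k x, ENNReal.ofReal_rpow_of_nonneg (indicator_nonneg
      (fun y _ => Real.rpow_nonneg (norm_nonneg _) _) x) hq0.le]
    by_cases hx : x ∈ T k
    · rw [indicator_of_mem hx, indicator_of_mem hx, hΦeq, ← Real.rpow_mul (norm_nonneg _),
        hpq.sub_one_mul_conj]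
    · rw [indicator_of_notMem hx, indicator_of_notMem hx, Real.zero_rpow hq0.ne',
        ENNReal.ofReal_zero]
  -- ### the bound `L k ≤ M^p`
  have hLk : ∀ k, L k ≤ ENNReal.ofReal (M ^ p) := by
    intro k
    have hstep := abs_setIntegral_mul_le_of_forall_test hS hFi hq1 hM hF (hKc k) (hKS k)
      (hgm k) (hgC k) (hgK k)
    -- the left-hand side is `(L k).toReal`
    have hlhs : ∫ x in S, F x * g k x ∂μ = (L k).toReal := by
      simp_rw [hFg k]
      rw [setIntegral_indicator (hTm k), inter_eq_right.2 (hTS k),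
        integral_eq_lintegral_of_nonneg_ae (Eventually.of_forall fun x => by positivity)
          (hFm.norm.measurable.pow_const p).aestronglyMeasurable]
      congr 1
      exact lintegral_congr fun x => (hΦeq x).symm
    -- the right-hand side is `M (L k)^{1/q}`
    have hrhs : (eLpNorm (g k) (ENNReal.ofReal q) μ).toReal = (L k).toReal ^ (1 / q) := by
      rw [eLpNorm_eq_lintegral_rpow_enorm_toReal hq0' ENNReal.ofReal_ne_top, hqr]
      simp_rw [hgq k]
      rw [lintegral_indicator (hTm k), ENNReal.toReal_rpow]
    rw [hlhs, hrhs, abs_of_nonneg ENNReal.toReal_nonneg] at hstep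
    -- solve `a ≤ M a^{1/q}` for `a = (L k).toReal`
    set a : ℝ := (L k).toReal with ha_def
    have ha0 : 0 ≤ a := ENNReal.toReal_nonneg
    have hale : a ≤ M ^ p := by
      rcases ha0.eq_or_lt with ha | ha
      · rw [← ha]; exact Real.rpow_nonneg hM p
      · have h1 : a ^ (1 / p) ≤ M := by
          have h2 : a * a ^ (-(1 / q)) ≤ M * a ^ (1 / q) * a ^ (-(1 / q)) :=
            mul_le_mul_of_nonneg_right hstep (Real.rpow_nonneg ha.le _)
          have h3 : a * a ^ (-(1 / q)) = a ^ (1 / p) := by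
            rw [show a ^ (1 / p) = a ^ ((1 : ℝ) + -(1 / q)) by congr 1; linarith,
              Real.rpow_add ha, Real.rpow_one]
          have h4 : M * a ^ (1 / q) * a ^ (-(1 / q)) = M := by
            rw [mul_assoc, ← Real.rpow_add ha, add_neg_cancel, Real.rpow_zero, mul_one]
          rwa [h3, h4] at h2
        calc a = (a ^ (1 / p)) ^ p := by
              rw [← Real.rpow_mul ha.le, one_div_mul_cancel hp0.ne', Real.rpow_one]
          _ ≤ M ^ p := Real.rpow_le_rpow (Real.rpow_nonneg ha.le _) h1 hp0.le
    calc L k = ENNReal.ofReal a := (ENNReal.ofReal_toReal (hLfin k)).symm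
      _ ≤ ENNReal.ofReal (M ^ p) := ENNReal.ofReal_le_ofReal hale
  -- ### monotone convergence
  have hind : ∀ x, S.indicator Φ x = ⨆ k, (T k).indicator Φ x := by
    intro x
    refine le_antisymm ?_ (iSup_le fun k => indicator_le_indicator_of_subset (hTS k)
      (fun _ => zero_le) x)
    by_cases hx : x ∈ S
    · obtain ⟨k₀, hk₀⟩ := hKcov x hx
      set k := max k₀ ⌈‖F x‖⌉₊ with hk
      have hxT : x ∈ T k := ⟨hk₀ k (le_max_left _ _),
        (Nat.le_ceil ‖F x‖).trans (by exact_mod_cast le_max_right k₀ _)⟩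
      rw [indicator_of_mem hx]
      exact le_iSup_of_le k (by rw [indicator_of_mem hxT])
    · rw [indicator_of_notMem hx]
      exact zero_le
  calc ∫⁻ x in S, Φ x ∂μ = ∫⁻ x, S.indicator Φ x ∂μ := (lintegral_indicator hS.measurableSet _).symm
    _ = ∫⁻ x, ⨆ k, (T k).indicator Φ x ∂μ := lintegral_congr hind
    _ = ⨆ k, ∫⁻ x, (T k).indicator Φ x ∂μ :=
        lintegral_iSup (fun k => hΦm.indicator (hTm k)) fun k l hkl x =>
          indicator_le_indicator_of_subset (hTmono hkl) (fun _ => zero_le) x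
    _ = ⨆ k, L k := by simp_rw [hL_def, lintegral_indicator (hTm _)]
    _ ≤ ENNReal.ofReal (M ^ p) := iSup_le hLk

/-- **`L^p` membership by duality against test functions** (`MemLp`/`eLpNorm` form of
`lintegral_rpow_enorm_le_of_forall_test`): under the same hypotheses `E ∈ L^p(S, μ)` and
`‖E‖_{L^p(S, μ)} ≤ M` (Brezis 2011, Prop. 3.5 / Thm. 4.11). [folklore] -/
theorem memLp_of_forall_test {S : Set G} (hS : IsOpen S) {E : G → ℝ}
    (hE : IntegrableOn E S μ) {p q : ℝ} (hpq : p.HolderConjugate q) {M : ℝ} (hM : 0 ≤ M)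
    (h : ∀ Ψ : G → ℝ, ContDiff ℝ (⊤ : ℕ∞) Ψ → HasCompactSupport Ψ → tsupport Ψ ⊆ S →
      |∫ x in S, E x * Ψ x ∂μ| ≤ M * (eLpNorm Ψ (ENNReal.ofReal q) μ).toReal) :
    MemLp E (ENNReal.ofReal p) (μ.restrict S) ∧
      eLpNorm E (ENNReal.ofReal p) (μ.restrict S) ≤ ENNReal.ofReal M := by
  have hp0 : 0 < p := hpq.pos
  have hp0' : ENNReal.ofReal p ≠ 0 := (ENNReal.ofReal_pos.2 hp0).ne'
  have hpr : (ENNReal.ofReal p).toReal = p := ENNReal.toReal_ofReal hp0.le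
  have hmain := lintegral_rpow_enorm_le_of_forall_test hS hE hpq hM h
  have hle : eLpNorm E (ENNReal.ofReal p) (μ.restrict S) ≤ ENNReal.ofReal M := by
    rw [eLpNorm_eq_lintegral_rpow_enorm_toReal hp0' ENNReal.ofReal_ne_top, hpr]
    calc (∫⁻ x in S, ‖E x‖ₑ ^ p ∂μ) ^ (1 / p)
        ≤ (ENNReal.ofReal (M ^ p)) ^ (1 / p) := by gcongr
      _ = ENNReal.ofReal M := by
          rw [ENNReal.ofReal_rpow_of_nonneg (Real.rpow_nonneg hM p) (by positivity), one_div,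
            Real.rpow_rpow_inv hM hp0.ne']
  exact ⟨⟨hE.aestronglyMeasurable, hle.trans_lt ENNReal.ofReal_lt_top⟩, hle⟩

end Literature.Analysis.FunctionSpaces
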